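import Summits.CriticalPhenomena.CardyFormulaZ2.Theses.CardyBoundaryCoulombGas
import Summits.CriticalPhenomena.CardyFormulaZ2.Theorems.HalfPlaneOneArmThird.Negative.EventForms
import Literature.Probability.Percolation.Crossings
import Literature.Probability.Percolation.RSW
import Literature.Probability.Percolation.RSWProofs
import Literature.Probability.Percolation.InequalitiesProofs
import Literature.Probability.Percolation.PlanarDuality
import Literature.Probability.Percolation.LatticeSymmetry
import Literature.Probability.Percolation.HalfPlaneCriticalProb
import Literature.Probability.LatticeModels.PercolationRowTransfer

/-!
# Line `lightcone-symplectic-passage` — skeleton for crux `HalfPlaneOneArmThird` (stmt-CriticalPhenomena-5662)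

Crux (route decl `Summit.CriticalPhenomena.CardyFormulaZ2.Theses.CardyBoundaryCoulombGas.HalfPlaneOneArmThird`,
shared verbatim with `CardyTotalPositivity.HalfPlaneOneArmThird`): for bond percolation on `ℤ²` at `p = 1/2`,
`log P[0 ↔ ∂([-n,n]×[0,n]) inside the half-box] / log n → -1/3` — the half-plane one-arm exponent
`β₁⁺ = 1/3` of bond-`ℤ²` (a theorem only on site-`𝕋`, Smirnov–Werner 2001; open on `ℤ²`).

## The line (idea card `Ideas/lightcone-symplectic-passage.md`, triage r1: pass ×3)

LEVER.  The wall-to-wall probability of the AXIS-PARALLEL strip `ℤ × {0,…,N}` (site `0` on the free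
wall `y = 0` joined inside the strip to the far wall `y = N`) is EXACTLY Ikhlef–Ponsaing's symplectic
character ratio (arXiv:1202.5476, eq. `inhomresult`, `P_b = χ_{L-1} χ_{L+1} / χ_L²`, `L = 2N+1`) read at
the LIGHT-CONE point `u = e^{-iπ/6}` of the spectral parameter (all `z_j² ≡ u^{±1}`, immaterial signs by
`W(C)`-invariance) instead of the homogeneous point `u = 1` (which is the DIAGONAL strip of `ℤ²`):
`μ(stripWallEvent N) = S(2N) S(2N+2) / S(2N+1)²`, `S(m) = sp_{λ(m)}(u,…,u)`, `λ(m)_j = ⌊(m-j)/2⌋`.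
Verified EXACTLY for `N = 1, 2, 3` (`7/9`, `2345/3481`, `12160165/19953723`) by three independent codes
(ideator 2, triagers r1-1/r1-2 by hand for `N ≤ 2`, and this planner's `compute/recheck_lightcone.py`,
which mirrors the definitions `Jphi`/`spMatrix`/`Sphi`/`passageRatio` of THIS file literally and also
reproduces IP's printed `3/4, 78/121, 247/425` at `φ = 0`).

SKELETON = 5 registered stubs + proved glue:

| stub | statement (informal) | size | status of the mathematics |
|---|---|---|---|
| `stub_lightconePassage` | `μ(stripWallEvent N) = passageRatio N (π/6)` for `N ≥ 1` | XL | exact identity, certified `N ≤ 3`; derivation = Sklyanin double-row transfer matrix at alternating inhomogeneities `e^{∓iπ/12}` (= brick wall of `(1+e_j)/2` = `PercolationRowTransfer`-type chain) + boundary qKZ Perron vector (Di Francesco–Zinn-Justin, de Gier–Pyatov, Zinn-Justin) + IP §3–4 (symmetry/recursion/degree) — physics-journal proofs to be redone as theorems (rigour template Hagendorf–Liénardy arXiv:2008.03220) |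
| `stub_diag_le_axis` | `passageRatio N 0 ≤ passageRatio N (π/6)` for `N ≥ 1` | L | NEW; endpoint form of the card's MonotoneAnisotropy (`P_b(L;φ)` increasing in `φ ∈ [0,π/6]`, exact for `L ≤ 19`, kit j009096 to `L ≤ 39`); ratio `1.0370, 1.0450, 1.0486, …, 1.0554 (L = 25)` |
| `stub_homRatio_lower` | `N^{-1/3-ε} ≤ passageRatio N 0` eventually | L | theorem-in-print chain: `passageRatio N 0 = A_V(2N+1)A_V(2N+3)/N_8(2N+2)²` (IP Prop. 4.7 ⟸ Okada math/0408234 Thm 2.4 + Kuperberg / Mills–Robbins–Rumsey–Andrews enumerations) `~ C·(2N+1)^{-1/3}` (IP Prop. 4.9, Barnes/Stirling) |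
| `stub_lcRatio_upper` | `passageRatio N (π/6) ≤ N^{-1/3+ε}` eventually | XL | HARDEST — no product formula at the torsion point (`S(m;π/6) = …, 9·59, 27·5·67, 3⁵·2579√3, 3⁷·36299`); candidate technologies: Riemann–Hilbert / Hankel asymptotics of the homogeneous U-turn six-vertex partition function at generic anisotropy (Bleher–Fokin type; parity gap `γ_even − γ_odd = −1/6`), or an upper comparison with `φ = 0`; numerically `θ_eff = .3545 → .3373 (L = 3..23)` drifting to `1/3` |
| `stub_arm_le_stripWall` | `μ(armEvt n) ≤ C·μ(stripWallEvent n)` | M | RSW/FKG gluing at `p = 1/2` (`C = 5`): first-exit decomposition of the arm by exit side + a top–bottom crossing of `[0,n]²` (prob `≥ 1/2`, `crossingProb_half_succ_self_holds`) meets the lateral arm (`exists_mem_support_of_crossing`) + `harris_fkg_holds` + `reflectIso 0` |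

PROVED here (no `sorry`): `stripWall_le_arm` (the other half of the sandwich, by first exit through the
landed `Negative.mem_armEvt_of_far`), the generic squeeze `tendsto_log_div_log_of_rpow_bounds`,
`lcRatioLower_of_diagLeAxis` (A2-MONO: STUBS 2+3 ⇒ the direct light-cone lower bound `LcRatioLower`),
`exponentAt_of_direct` (identity + two-sided light-cone bounds + RSW half ⇒ `ExponentAt half (1/3)`; the
ready-made composition for a lead who bypasses A2-MONO), the composition `HalfPlaneOneArmThird_of :
Registered.stub_lightconePassage → Registered.stub_diag_le_axis → Registered.stub_homRatio_lower →
Registered.stub_lcRatio_upper → Registered.stub_arm_le_stripWall → CardyBoundaryCoulombGas.HalfPlaneOneArmThird`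
(kernel-checked; the `Registered.stub_*` are name-keyed `Prop` aliases of the stub statements — the device of
`ABC/…/Lines/inert-box-collapse.lean` — and the unnamed `example`s at the end wire the sorried stubs in, so
`HalfPlaneOneArmThird_of` is the ONLY theorem of the file concluding the crux), the partial result
`limsup_le_of_lower` (STUBS 1–3 ⇒ `β₁⁺ ≤ 1/3` in limsup form, DKKMO-free), the NECESSITY lemmas
`lcRatioUpper_of_crux` / `lcRatioLower_of_crux` (crux + STUB 1 (+ STUB 5) ⇒ the light-cone power bounds: the
analytic stubs at `π/6` are lossless transfers, not strengthenings), and the DICTIONARY PINS `Sphi_two/three/four`,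
`passageRatio_one`, `passageRatio_one_lightcone = 7/9`, `passageRatio_one_hom = 3/4` (so the Lean definitions
provably reproduce the hand values, and `stub_diag_le_axis` at `N = 1` is a checked `example`).

DISPROOF USED (`Cruxes/HalfPlaneOneArmThird/Disproof.lean`, cdisprove; landed as
`Theorems/HalfPlaneOneArmThird/Negative/{Basics,Window,ParameterPinned,EventForms}.lean`, p72872 p73206 p73356
p73637, IMPORTED here): `crux_iff` — the composition rewrites the crux into `ExponentAt half (1/3)` and the
events `armEvt`/`prob` of the Negative files are used VERBATIM (no private copy of the crux event);
`crux_false_of_ne_half` ("false without `p = 1/2`", both sides) — honoured: `stub_lightconePassage` exists only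
at the self-dual point (equal TL tile weights `[q/a²]/[qa²] = 1/2 ⟺ a⁴ = -q ⟺ p_h = p_v = 1/2`; off `1/2` the
column chain leaves the commuting Yang–Baxter family), `stub_arm_le_stripWall` is an RSW statement at `1/2`,
and the two analytic stubs carry the two sides (`stub_homRatio_lower` = not subcritical, power law not
exponential; `stub_lcRatio_upper` = not supercritical, decay to `0` at the right speed); `exponentAt_half_window`
(`α₀ ≤ β ≤ 1`) — the value `1/3` produced is interior, consistent; `prob_eq_far` — faithfulness of `armEvt` is
inherited. No `_false_without_` hypothesis theorem and no refuted strengthening exist for this crux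
(`ledger negatives --problem CriticalPhenomena`: nothing on arm exponents); no stub is an instance of a landed
Negative lemma (the Negative lemmas refute only `p ≠ 1/2` variants and bound `β ∈ [α₀,1]`).
-/

noncomputable section

namespace Summit.CriticalPhenomena.CardyFormulaZ2.Cruxes.HalfPlaneOneArmThird.LightconeSymplecticPassage

open MeasureTheory Filter Topology
open Literature.Probability.Percolation Literature.Probability.LatticeModels
open Summit.CriticalPhenomena.CardyFormulaZ2.Theorems.HalfPlaneOneArmThird.Negative

/-! ## Objects -/

/-- The critical bond-percolation measure `P_{1/2}` on `ℤ²`. -/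
abbrev μ : Measure (BondConfig (Site 2)) := bondPercolation (zdGraph 2) half

/-- The closed horizontal strip `0 ≤ v 1 ≤ N` of `ℤ²` (`N + 1` vertex rows; bottom wall `y = 0` free,
far wall `y = N`). -/
def strip (N : ℕ) : Set (Site 2) := {v | 0 ≤ v 1 ∧ v 1 ≤ (N : ℤ)}

/-- The far wall `{v 1 = N}` of the strip. -/
def topWall (N : ℕ) : Set (Site 2) := {v | v 1 = (N : ℤ)}

/-- STRIP WALL-TO-WALL EVENT: the free-wall site `0` is joined INSIDE the strip `0 ≤ y ≤ N` to the far wall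
`{y = N}` (wiring the far wall does not change the event).  Its probability is the stationary boundary
passage probability of the axis-parallel strip of `N + 1` rows = Ikhlef–Ponsaing's `P_b` at `L = 2N + 1`
read at the light-cone point (`stub_lightconePassage`).  `N = 1`: `7/9`. -/
def stripWallEvent (N : ℕ) : Set (BondConfig (Site 2)) := openCrossing (strip N) {0} (topWall N)

/-- `h_k(u,…,u,ū,…,ū)` (`m` copies of each, `u = e^{-iφ}`), the complete homogeneous symmetric polynomial of
the symplectic alphabet at equal arguments, as the real binomial sum
`∑_{a=0}^{k} C(a+m-1,m-1) C(k-a+m-1,m-1) cos((2a-k)φ)`; `0` for `k < 0`.  (`φ = π/6`: light-cone / axis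
strip; `φ = 0`: homogeneous / diagonal strip, `h_k = C(k+2m-1, 2m-1)`; in between: the critical anisotropic
axis strips `p_h = sin(2π/3+φ)/sin(π/3+φ)`, `p_v = sin φ / sin(π/3+φ)` by `Z`-invariance.) -/
def Jphi (m : ℕ) (φ : ℝ) (k : ℤ) : ℝ :=
  if k < 0 then 0 else
    ∑ a ∈ Finset.range (k.toNat + 1),
      ((Nat.choose (a + m - 1) (m - 1) : ℝ) * (Nat.choose (k.toNat - a + m - 1) (m - 1) : ℝ)) *
        Real.cos ((2 * (a : ℝ) - (k.toNat : ℝ)) * φ)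

/-- The symplectic Jacobi–Trudi matrix (Fulton–Harris (24.24): first column `J_{λ_i-i+1}`, column
`j ≥ 2`: `J_{λ_i-i+j} + J_{λ_i-i-j+2}`, 1-indexed) of the `Sp(2m)` highest weight `λ(m)_i = ⌊(m-i)/2⌋` at `m`
equal arguments `e^{-iφ}`, 0-indexed and truncated to its top-left `(m-2) × (m-2)` block (rows `m-1`, `m` of the
full matrix are `(0,…,0,1,J_1)`, `(0,…,0,1)`, so the full determinant equals this one). -/
def spMatrix (m : ℕ) (φ : ℝ) : Matrix (Fin (m - 2)) (Fin (m - 2)) ℝ := fun i j =>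
  Jphi m φ ((((m - (i.val + 1)) / 2 : ℕ) : ℤ) - (i.val : ℤ) + (j.val : ℤ)) +
    (if j.val = 0 then 0 else Jphi m φ ((((m - (i.val + 1)) / 2 : ℕ) : ℤ) - (i.val : ℤ) - (j.val : ℤ)))

/-- `S(m; φ) = sp_{λ(m)}(u,…,u)`, `u = e^{-iφ}`: the symplectic character at `m` equal arguments.
`S(m; π/6) = 1, 1, 1, 3√3, 21, 531, 9045, 626697√3, 79385913` and `S(m; 0) = 1, 1, 1, 6, 27, 891, 18954,
3346110, 343310886` for `m = 0..8` (`compute/recheck_lightcone.py`). -/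
def Sphi (m : ℕ) (φ : ℝ) : ℝ := (spMatrix m φ).det

/-- Ikhlef–Ponsaing's passage ratio `S(2N) S(2N+2) / S(2N+1)²` at spectral angle `φ`: by `inhomresult` the
wall-to-wall probability of the width-`(2N+1)` TL(1) strip with spectral parameters `z_j² ≡ e^{∓iφ}`.
`passageRatio N (π/6) = 7/9, 2345/3481, 12160165/19953723` (= axis strip, `stub_lightconePassage`) and
`passageRatio N 0 = 3/4, 78/121, 247/425` (= IP Prop. 4.7, the diagonal strip) for `N = 1, 2, 3`. -/
def passageRatio (N : ℕ) (φ : ℝ) : ℝ :=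
  Sphi (2 * N) φ * Sphi (2 * N + 2) φ / Sphi (2 * N + 1) φ ^ 2

/-! ## The five stub STATEMENTS (named `Prop`s; the registered `stub_*` theorems below restate them verbatim) -/

/-- Statement of STUB 1 (the light-cone identity). -/
def LightconePassage : Prop :=
  ∀ N : ℕ, 1 ≤ N → μ.real (stripWallEvent N) = passageRatio N (Real.pi / 6)

/-- Statement of STUB 2 (diagonal ≤ axis: endpoint form of monotone anisotropy). -/
def DiagLeAxis : Prop :=
  ∀ N : ℕ, 1 ≤ N → passageRatio N 0 ≤ passageRatio N (Real.pi / 6)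

/-- Statement of STUB 3 (lower power bound at the homogeneous point, exponent `-1/3`). -/
def HomRatioLower : Prop :=
  ∀ ε : ℝ, 0 < ε → ∀ᶠ N : ℕ in atTop, (N : ℝ) ^ (-(1 / 3 : ℝ) - ε) ≤ passageRatio N 0

/-- Statement of STUB 4 (upper power bound at the light-cone point, exponent `-1/3`). -/
def LcRatioUpper : Prop :=
  ∀ ε : ℝ, 0 < ε → ∀ᶠ N : ℕ in atTop, passageRatio N (Real.pi / 6) ≤ (N : ℝ) ^ (-(1 / 3 : ℝ) + ε)

/-- Statement of STUB 5 (RSW half of the strip ↔ half-box sandwich). -/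
def ArmLeStripWall : Prop :=
  ∃ C : ℝ, 0 < C ∧ ∀ n : ℕ, 1 ≤ n → μ.real (armEvt n) ≤ C * μ.real (stripWallEvent n)

/-! ## The registered stubs (`sorry` lives ONLY in these five theorems) -/

/-- **STUB 1 · `stub_lightconePassage`** (size XL; the lever).  For every `N ≥ 1` the wall-to-wall
probability of the axis-parallel critical strip of `N + 1` rows equals Ikhlef–Ponsaing's symplectic passage
ratio at the light-cone point: `μ(stripWallEvent N) = S(2N;π/6) S(2N+2;π/6) / S(2N+1;π/6)²`.
WHY PLAUSIBLY TRUE: exact match for `N = 1, 2, 3` against the stationary column-to-column Markov chain of the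
strip (three independent implementations; `7/9 = 1 - ½(2/3)²` also by hand), structural reason = Sklyanin's
double-row transfer matrix `t(w; a, a⁻¹, a, a⁻¹, …)` at `w = a = e^{-iπ/12}` is the brick wall of isotropic
`(1 + e_j)/2` tiles (both surviving face weights `[q/a²]/[qa²] = 1/2` iff `a⁴ = -q`, `q = e^{2iπ/3}`), i.e. the
column chain of THIS strip (cf. the remark `T_S = ∏ (1+eᵢ)/2` of `PercolationRowTransfer`); the commuting family
has a `w`-independent Perron vector = the Laurent-polynomial boundary-qKZ solution `Ψ(z⃗)`; IP compute
`⟨Ψ̄|ρ|Ψ⟩/Z²` for arbitrary `z⃗` as `χ_{L-1}χ_{L+1}/χ_L²` (symmetry + recursions at `4(L-2) ≥ 2L-1` points +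
degree), and `χ` is invariant under each `z_i ↦ 1/z_i`, so the alternating point collapses to `u = a²`.
PROOF PLAN (helper lemmas ride with `--supports`): (a) column chain & bilinear form: `μ(stripWallEvent N) =
∑ ψ(π⁻) 2^{-N} ψ(π⁺) 1[0 ∼ ⋆ in π⁻ ∨ V ∨ π⁺]` with `ψ` the stationary law of the `RowState`-type chain
(ergodic theorem for the i.i.d. column environment + reflection symmetry); (b) `ψ ∝ Ψ(a^{±1})` (qKZ exchange
relations ⟹ eigenvector; Perron–Frobenius uniqueness); (c) IP Props 3.4, 4.1–4.5 as theorems.  SOURCES: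
arXiv:1202.5476 §3–4; math-ph/0410061, math-ph/0504032, arXiv:0710.5362 (qKZ/Perron); arXiv:2008.03220
(rigour template); Destri–de Vega NPB 290 (1987) (light-cone lattice = alternating inhomogeneities).
DISPROOF: uses `p = 1/2` essentially (`crux_false_of_ne_half`). -/
theorem stub_lightconePassage :
    ∀ N : ℕ, 1 ≤ N → μ.real (stripWallEvent N) = passageRatio N (Real.pi / 6) := by
  sorry

/-- **STUB 2 · `stub_diag_le_axis`** (size L; NEW statement, pure algebra/combinatorics — no percolation in
it).  For every `N ≥ 1`, `passageRatio N 0 ≤ passageRatio N (π/6)`: the diagonal (homogeneous-point) strip of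
width index `N` is harder to cross wall-to-wall than the axis (light-cone) strip.  WHY PLAUSIBLY TRUE: exact
rational data `passageRatio N (π/6) / passageRatio N 0 = 1.0370, 1.0450, 1.0486, 1.0506, 1.0519, 1.0529,
1.0536, 1.0541, 1.0545, …, 1.0554` (`N = 1..12`, converging, ideator's `phi_family_exact.py`), and the stronger
MONOTONE ANISOTROPY `φ ↦ passageRatio N φ` increasing on `[0, π/3)` holds exactly for all `2N+1 ≤ 19` (kit
j009096 pushes to `≤ 39`); mechanism candidates: (i) a Russo formula along the critical anisotropic family
`p_h + p_v = 1` of the axis strip ("vertical pivotals outnumber horizontal ones for the bottom-site-to-top-wall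
event"), which needs STUB 1 for general `φ`; (ii) positivity of `∂_φ` of the character ratio from the
branching/positivity structure of `sp` characters in `c = 2cos φ` (every `Jphi m φ k` is a Gegenbauer value
`C_k^{(m)}(cos φ)`); (iii) a direct coupling between the diagonal and the axis strip.  A single `N` with ratio
`< 1` kills this stub (and closure A2-MONO of the card) but not the line (replace STUBS 2+3 by a direct lower
bound at `π/6`).  SOURCES: card §(3b); arXiv:1202.5476 eq. `inhomresult`; Baxter 1978 / Kenyon 2002
(`Z`-invariance). -/
theorem stub_diag_le_axis :
    ∀ N : ℕ, 1 ≤ N → passageRatio N 0 ≤ passageRatio N (Real.pi / 6) := by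
  sorry

/-- **STUB 3 · `stub_homRatio_lower`** (size L; theorems in print).  `∀ ε > 0`, eventually
`N^{-1/3-ε} ≤ passageRatio N 0`.  WHY TRUE: at `φ = 0`, `Jphi m 0 k = C(k+2m-1, 2m-1)` and
`passageRatio N 0 = A_V(2N+1) A_V(2N+3) / N_8(2N+2)²` (Ikhlef–Ponsaing Prop. 4.7: the homogeneous symplectic
characters are `3^{·}` × the vertically-symmetric ASM numbers `A_V(2n+1) = ∏_{i<n}(3i+2)(6i+3)!(2i+1)!/
((4i+2)!(4i+3)!)` and the CSTCPP numbers `N_8` — Okada math/0408234 Thm 2.4(3) + Kuperberg math/0008184 +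
Mills–Robbins–Rumsey/Andrews; checked here: `3/4, 78/121, 247/425`), and `(2N+1)^{1/3}·passageRatio N 0 →
C = 9·2^{-5/3} Γ(1/3)Γ(5/6)/(Γ(1/6)Γ(2/3))` (IP Prop. 4.9, Barnes-`G`/Stirling) — only the LOWER half and no
constant are registered (what the composition consumes); the sister line `ip-passage-stirling` wants the same
closed form for its `IPClosedForm ∧ IPAsymptotics`, so one proof serves both.  PROOF PLAN: (a) closed form of
the binomial determinant `Sphi m 0` (Okada-type determinant evaluation, or cite-as-fact if vendored), (b)
`Real.Gamma`/Stirling asymptotics of the product ratio (Mathlib `Real.Gamma`, `Stirling`).  SOURCES: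
arXiv:1202.5476 Props 4.7, 4.9; math/0408234; math/0008184. -/
theorem stub_homRatio_lower :
    ∀ ε : ℝ, 0 < ε → ∀ᶠ N : ℕ in atTop, (N : ℝ) ^ (-(1 / 3 : ℝ) - ε) ≤ passageRatio N 0 := by
  sorry

/-- **STUB 4 · `stub_lcRatio_upper`** (size XL; the HARDEST stub — where the crux's difficulty is transferred
to).  `∀ ε > 0`, eventually `passageRatio N (π/6) ≤ N^{-1/3+ε}`: the explicit algebraic sequence
`S(2N)S(2N+2)/S(2N+1)²` at the torsion point `u = e^{-iπ/6}` decays at least like `N^{-1/3+o(1)}`.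
WHY PLAUSIBLY TRUE: effective exponents `θ(L) = .3545, .3484, .3449, .3427, .3412, .3401, .3393, .3386, .3381,
.3377, .3373` (`L = 3..23`) with a `c/L` drift, same drift as at `φ = 0` where the limit `1/3` is a theorem;
modulo STUBS 1, 5 it is implied by the crux itself (`passageRatio N (π/6) = μ(stripWallEvent N) ≤ μ(armEvt N)`).
WHY HARD: no product formula (`S(m;π/6)` carries the primes `59, 67, 2579, 36299`), so IP's Prop. 4.9 route is
closed; Gorin–Panova torsion-point asymptotics (arXiv:1301.0634) keep only finitely many variables off `1`.
CANDIDATE ROUTES: (A2-RH) `Sphi m φ` is the homogeneous U-turn-boundary six-vertex partition function at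
`Δ = -1/2` with all spectral parameters `e^{-iπ/12}` off the reflecting end's preferred value (Okada Thm 2.4(3)
read backwards; Tsuchiya determinant → Hankel form in the homogeneous limit); a Bleher–Fokin-type
Riemann–Hilbert analysis (math-ph/0510033; reflecting end: Ribeiro–Korepin arXiv:1409.1212 leading order)
giving `log S(m) = A m² + B m + γ_{m mod 2} log m + O(1)` with PARITY GAP `γ_even - γ_odd = -1/6` is exactly this
stub (the `m²`, `m` coefficients must agree across parities — a priori forced by `1/(4N) ≤ μ(stripWallEvent N)
≤ 1` once STUB 1 holds); (A2-CMP) an upper comparison `passageRatio N (π/6) ≤ K · passageRatio N 0` (the ratio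
converges numerically to `1.058`) + the two-sided print asymptotics at `φ = 0`; (A2-WEYL) the signed
two-component discrete Coulomb sum from the confluent Weyl alternant with 12-periodic phases (card, fourth
handle).  If all fail, the lead may import the diagonal exponent through DKKMO (`dkkmo_crossing_rotation_invariance`,
triage F1) — at which point this line degenerates into the sister line plus the DKKMO-free partial result
`limsup -log μ(armEvt n)/log n ≤ 1/3` from STUBS 1–3 (`limsup_le_of_lower` below).  SOURCES: arXiv:1202.5476
§4.4; math-ph/0510033; arXiv:1409.1212; arXiv:1610.04006 p.13 (reflecting-case asymptotics not extracted). -/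
theorem stub_lcRatio_upper :
    ∀ ε : ℝ, 0 < ε → ∀ᶠ N : ℕ in atTop, passageRatio N (Real.pi / 6) ≤ (N : ℝ) ^ (-(1 / 3 : ℝ) + ε) := by
  sorry

/-- **STUB 5 · `stub_arm_le_stripWall`** (size M; RSW at `p = 1/2`, provable now from tree facts).  There is
`C > 0` (in fact `C = 5`) with `μ(armEvt n) ≤ C · μ(stripWallEvent n)` for all `n ≥ 1`.  PROOF PLAN: an arm
from `0` to the outer boundary of `[-n,n]×[0,n]` exits through the top (⊆ `stripWallEvent n`, the half-box lies
in the strip) or through the right or left side.  Right side: after its last visit to `{x ≤ 0}` the arm is a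
left–right open crossing of the square `[0,n]²`; a top–bottom open crossing of `[0,n]²` (probability
`crossingProb half n n ≥ 1/2`: `half_le_crossingProb_self crossingProb_half_succ_self_holds` + `real_tbCrossing`)
shares a vertex with it (`exists_mem_support_of_crossing`, the discrete Jordan lemma of `PlanarDuality`), so on the
intersection `0 ↔ {y = n}` inside `[-n,n]×[0,n] ⊆ strip n`; both events are increasing
(`isUpperSet_openCrossing`) hence `μ(right-exit ∩ TB) ≥ μ(right-exit)/2` (`harris_fkg_holds`), i.e.
`μ(right-exit) ≤ 2 μ(stripWallEvent n)`; left side idem by `reflectIso 0` (`bondPercolation_real_image`).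
Total `C = 1 + 2 + 2`.  SOURCES: Grimmett 1999 §11.7; Bollobás–Riordan 2006 Ch. 3; tree decls as named. -/
theorem stub_arm_le_stripWall :
    ∃ C : ℝ, 0 < C ∧ ∀ n : ℕ, 1 ≤ n → μ.real (armEvt n) ≤ C * μ.real (stripWallEvent n) := by
  sorry

/-! ### Consistency: each named statement IS its registered stub (definitionally) -/

theorem lightconePassage_holds : LightconePassage := stub_lightconePassage
theorem diagLeAxis_holds : DiagLeAxis := stub_diag_le_axis
theorem homRatioLower_holds : HomRatioLower := stub_homRatio_lower
theorem lcRatioUpper_holds : LcRatioUpper := stub_lcRatio_upper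
theorem armLeStripWall_holds : ArmLeStripWall := stub_arm_le_stripWall

/-! ### Name-keyed aliases of the five statements (the hypotheses of the composition; the native skeleton
audit admits a hypothesis by the last name component of its head constant) -/
namespace Registered

/-- Alias of `LightconePassage` keyed by the registered stub name. -/
abbrev stub_lightconePassage : Prop := LightconePassage
/-- Alias of `DiagLeAxis` keyed by the registered stub name. -/
abbrev stub_diag_le_axis : Prop := DiagLeAxis
/-- Alias of `HomRatioLower` keyed by the registered stub name. -/
abbrev stub_homRatio_lower : Prop := HomRatioLower
/-- Alias of `LcRatioUpper` keyed by the registered stub name. -/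
abbrev stub_lcRatio_upper : Prop := LcRatioUpper
/-- Alias of `ArmLeStripWall` keyed by the registered stub name. -/
abbrev stub_arm_le_stripWall : Prop := ArmLeStripWall

end Registered

/-! ## Proved glue (no `sorry` below this line) -/

/-- The strip lies in the upper half-plane `uhp = {0 ≤ v 1}` of `Negative.EventForms`. -/
theorem strip_subset_uhp (N : ℕ) : strip N ⊆ uhp := fun _ hv => hv.1

/-- **Sandwich, inclusion half (PROVED):** `μ(stripWallEvent n) ≤ μ(armEvt n)` for every `n` — a wall-to-wall
path inside the strip is a half-plane connection from `0` to a site at height `n ∉ B(n-1)`, which contains a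
half-box arm by first exit (`Negative.mem_armEvt_of_far`); `n = 0` is the sure event on both sides. -/
theorem stripWall_le_arm (n : ℕ) : μ.real (stripWallEvent n) ≤ μ.real (armEvt n) := by
  rcases Nat.eq_zero_or_pos n with rfl | hn
  · rw [armEvt_zero]
    exact measureReal_mono (Set.subset_univ _) (measure_ne_top _ _)
  · refine ENNReal.toReal_mono (measure_ne_top _ _) (measure_mono_ae ?_)
    filter_upwards [ae_subset_edgeSet (zdGraph 2) half] with ω hω hsw
    obtain ⟨x, hx, y, hy, hconn⟩ := hsw
    rw [Set.mem_singleton_iff] at hx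
    subst hx
    have hy' : y 1 = (n : ℤ) := hy
    refine mem_armEvt_of_far hn hω (y := y) ?_ (openConnIn_mono (strip_subset_uhp n) 0 y hconn)
    intro hyb
    rw [mem_box] at hyb
    have h1 := hyb 1
    push_cast [Nat.cast_sub hn] at h1
    omega

/-- **Generic squeeze (PROVED):** two-sided power bounds with `o(1)` slack in the exponent give the log-ratio
limit: if eventually `n^{-β-ε} ≤ P n ≤ C n^{-β+ε}` for every `ε > 0`, then `log P n / log n → -β`. -/
theorem tendsto_log_div_log_of_rpow_bounds {P : ℕ → ℝ} {β C : ℝ} (hC : 0 < C)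
    (hlo : ∀ ε : ℝ, 0 < ε → ∀ᶠ n : ℕ in atTop, (n : ℝ) ^ (-β - ε) ≤ P n)
    (hup : ∀ ε : ℝ, 0 < ε → ∀ᶠ n : ℕ in atTop, P n ≤ C * (n : ℝ) ^ (-β + ε)) :
    Tendsto (fun n : ℕ ↦ Real.log (P n) / Real.log n) atTop (𝓝 (-β)) := by
  rw [tendsto_order]
  constructor
  · intro a ha
    obtain ⟨ε, hε, hεa⟩ : ∃ ε : ℝ, 0 < ε ∧ a < -β - ε := ⟨(-β - a) / 2, by linarith, by linarith⟩
    filter_upwards [hlo ε hε, eventually_ge_atTop 2] with n hn h2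
    have hn2 : (2 : ℝ) ≤ n := by exact_mod_cast h2
    have hnpos : (0 : ℝ) < n := by linarith
    have hlog : 0 < Real.log n := Real.log_pos (by linarith)
    have hpow : 0 < (n : ℝ) ^ (-β - ε) := Real.rpow_pos_of_pos hnpos _
    have h1 : (-β - ε) * Real.log n ≤ Real.log (P n) := by
      have := Real.log_le_log hpow hn
      rwa [Real.log_rpow hnpos] at this
    rw [lt_div_iff₀ hlog]
    exact lt_of_lt_of_le (mul_lt_mul_of_pos_right hεa hlog) h1
  · intro a ha
    obtain ⟨ε, hε, hεa⟩ : ∃ ε : ℝ, 0 < ε ∧ -β + 2 * ε ≤ a := ⟨(a + β) / 2, by linarith, by linarith⟩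
    have hlogC : ∀ᶠ n : ℕ in atTop, Real.log C < ε * Real.log n := by
      have ht : Tendsto (fun n : ℕ => ε * Real.log n) atTop atTop :=
        (Real.tendsto_log_atTop.comp tendsto_natCast_atTop_atTop).const_mul_atTop hε
      exact ht.eventually_gt_atTop _
    filter_upwards [hup ε hε, hlo ε hε, eventually_ge_atTop 2, hlogC] with n hn hn' h2 hC'
    have hn2 : (2 : ℝ) ≤ n := by exact_mod_cast h2
    have hnpos : (0 : ℝ) < n := by linarith
    have hlog : 0 < Real.log n := Real.log_pos (by linarith)
    have hP : 0 < P n := (Real.rpow_pos_of_pos hnpos _).trans_le hn'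
    have hpow : 0 < (n : ℝ) ^ (-β + ε) := Real.rpow_pos_of_pos hnpos _
    have h1 : Real.log (P n) ≤ Real.log C + (-β + ε) * Real.log n := by
      have := Real.log_le_log hP hn
      rwa [Real.log_mul hC.ne' hpow.ne', Real.log_rpow hnpos] at this
    rw [div_lt_iff₀ hlog]
    calc Real.log (P n) ≤ Real.log C + (-β + ε) * Real.log n := h1
      _ < ε * Real.log n + (-β + ε) * Real.log n := by linarith [hC']
      _ = (-β + 2 * ε) * Real.log n := by ring
      _ ≤ a * Real.log n := mul_le_mul_of_nonneg_right hεa hlog.le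

/-- The DIRECT lower power bound at the light-cone point — NOT a registered stub: the A2-MONO route derives it
from STUBS 2 + 3 (`lcRatioLower_of_diagLeAxis`); a lead who bypasses A2-MONO proves this instead and re-cuts the
skeleton (`exponentAt_of_direct` is the ready-made composition).  It is implied by the crux given STUBS 1 + 5
(`lcRatioLower_of_crux`), so it is never stronger than needed. -/
def LcRatioLower : Prop :=
  ∀ ε : ℝ, 0 < ε → ∀ᶠ N : ℕ in atTop, (N : ℝ) ^ (-(1 / 3 : ℝ) - ε) ≤ passageRatio N (Real.pi / 6)

/-- A2-MONO: diagonal ≤ axis and the homogeneous-point lower bound give the light-cone lower bound. -/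
theorem lcRatioLower_of_diagLeAxis (h₂ : DiagLeAxis) (h₃ : HomRatioLower) : LcRatioLower := by
  intro ε hε
  filter_upwards [h₃ ε hε, eventually_ge_atTop 1] with N hN h1
  exact hN.trans (h₂ N h1)

/-- Lower power bound for the wall-to-wall probability of the axis strip, from STUB 1 and `LcRatioLower`. -/
theorem stripWall_lower (h₁ : LightconePassage) (hlo : LcRatioLower) :
    ∀ ε : ℝ, 0 < ε → ∀ᶠ N : ℕ in atTop, (N : ℝ) ^ (-(1 / 3 : ℝ) - ε) ≤ μ.real (stripWallEvent N) := by
  intro ε hε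
  filter_upwards [hlo ε hε, eventually_ge_atTop 1] with N hN h1
  calc (N : ℝ) ^ (-(1 / 3 : ℝ) - ε) ≤ passageRatio N (Real.pi / 6) := hN
    _ = μ.real (stripWallEvent N) := (h₁ N h1).symm

/-- **The DKKMO-free partial result (PROVED modulo STUBS 1–3 only):** `β₁⁺ ≤ 1/3` on bond-`ℤ²` in limsup form —
eventually `log P_{1/2}[armEvt n] / log n ≥ -1/3 - ε` for every `ε > 0` (against the best proved `β₁⁺ ≤ 1/2`). -/
theorem limsup_le_of_lower (h₁ : LightconePassage) (h₂ : DiagLeAxis) (h₃ : HomRatioLower) :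
    ∀ ε : ℝ, 0 < ε → ∀ᶠ n : ℕ in atTop, -(1 / 3 : ℝ) - ε ≤ Real.log (prob half n) / Real.log n := by
  intro ε hε
  filter_upwards [stripWall_lower h₁ (lcRatioLower_of_diagLeAxis h₂ h₃) ε hε, eventually_ge_atTop 2]
    with n hn h2
  have hn2 : (2 : ℝ) ≤ n := by exact_mod_cast h2
  have hnpos : (0 : ℝ) < n := by linarith
  have hlog : 0 < Real.log n := Real.log_pos (by linarith)
  have hpow : 0 < (n : ℝ) ^ (-(1 / 3 : ℝ) - ε) := Real.rpow_pos_of_pos hnpos _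
  have hle : (n : ℝ) ^ (-(1 / 3 : ℝ) - ε) ≤ prob half n := hn.trans (stripWall_le_arm n)
  have h1 : (-(1 / 3 : ℝ) - ε) * Real.log n ≤ Real.log (prob half n) := by
    have := Real.log_le_log hpow hle
    rwa [Real.log_rpow hnpos] at this
  rwa [le_div_iff₀ hlog]

/-- **Composition, direct form (PROVED):** the light-cone identity, two-sided power bounds at the light-cone point
and the RSW half of the sandwich give `ExponentAt half (1/3)` (= the crux by `Negative.crux_iff`).  Concludes
`ExponentAt`, not the crux by name, so that `HalfPlaneOneArmThird_of` stays the unique crux-concluding theorem. -/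
theorem exponentAt_of_direct (h₁ : LightconePassage) (hlo : LcRatioLower) (h₄ : LcRatioUpper)
    (h₅ : ArmLeStripWall) : ExponentAt half (1 / 3) := by
  obtain ⟨C, hC, hCle⟩ := h₅
  refine tendsto_log_div_log_of_rpow_bounds (P := prob half) (β := 1 / 3) (C := C) hC ?_ ?_
  · intro ε hε
    filter_upwards [stripWall_lower h₁ hlo ε hε] with N hN
    exact hN.trans (stripWall_le_arm N)
  · intro ε hε
    filter_upwards [h₄ ε hε, eventually_ge_atTop 1] with N hN h1
    calc prob half N = μ.real (armEvt N) := rfl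
      _ ≤ C * μ.real (stripWallEvent N) := hCle N h1
      _ = C * passageRatio N (Real.pi / 6) := by rw [h₁ N h1]
      _ ≤ C * (N : ℝ) ^ (-(1 / 3 : ℝ) + ε) := mul_le_mul_of_nonneg_left hN hC.le

/-! ## The composition: the five stubs imply the crux, BY NAME (kernel-checked; no `sorry`) -/

/-- **`HalfPlaneOneArmThird_of`** — the glue of the line: the light-cone identity (STUB 1), the lower power
bound at the light-cone point (STUBS 2 + 3, A2-MONO), the upper power bound (STUB 4) and the RSW sandwich
(STUB 5 + `stripWall_le_arm`) give `log P_{1/2}[armEvt n] / log n → -1/3`, i.e. the crux through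
`Negative.crux_iff`. -/
theorem HalfPlaneOneArmThird_of (h₁ : Registered.stub_lightconePassage) (h₂ : Registered.stub_diag_le_axis)
    (h₃ : Registered.stub_homRatio_lower) (h₄ : Registered.stub_lcRatio_upper)
    (h₅ : Registered.stub_arm_le_stripWall) :
    Summit.CriticalPhenomena.CardyFormulaZ2.Theses.CardyBoundaryCoulombGas.HalfPlaneOneArmThird :=
  crux_iff.mpr (exponentAt_of_direct h₁ (lcRatioLower_of_diagLeAxis h₂ h₃) h₄ h₅)

/-! ## Necessity (PROVED): the light-cone power bounds are LOSSLESS transfers of the crux's two halves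

Given STUB 1 (and STUB 5 for the lower half) the crux IMPLIES `LcRatioUpper` and `LcRatioLower`; so the analytic
stubs at `π/6` are equivalent to the crux modulo the identity and the sandwich — no over-claim hides in them, and
the cdisprove verdict "no refutation of the crux from rigorous `ℤ²` bounds" transfers to them verbatim. -/

/-- An exponent `β` in the sense of `ExponentAt half β` gives two-sided power bounds with `o(1)` exponent slack. -/
theorem rpow_bounds_of_exponentAt {β : ℝ} (h : ExponentAt half β) (ε : ℝ) (hε : 0 < ε) :
    ∀ᶠ n : ℕ in atTop, (n : ℝ) ^ (-β - ε) ≤ prob half n ∧ prob half n ≤ (n : ℝ) ^ (-β + ε) := by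
  have hlo := (tendsto_order.1 h).1 (-β - ε) (by linarith)
  have hup := (tendsto_order.1 h).2 (-β + ε) (by linarith)
  filter_upwards [hlo, hup, eventually_ge_atTop 2] with n h1 h2 hn
  have hn2 : (2 : ℝ) ≤ n := by exact_mod_cast hn
  have hnpos : (0 : ℝ) < n := by linarith
  have hlog : 0 < Real.log n := Real.log_pos (by linarith)
  have hP : 0 < prob half n := prob_pos (by simp) n
  constructor
  · rw [lt_div_iff₀ hlog] at h1
    have : Real.log ((n : ℝ) ^ (-β - ε)) < Real.log (prob half n) := by rwa [Real.log_rpow hnpos]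
    exact ((Real.log_lt_log_iff (Real.rpow_pos_of_pos hnpos _) hP).1 this).le
  · rw [div_lt_iff₀ hlog] at h2
    have : Real.log (prob half n) < Real.log ((n : ℝ) ^ (-β + ε)) := by rwa [Real.log_rpow hnpos]
    exact ((Real.log_lt_log_iff hP (Real.rpow_pos_of_pos hnpos _)).1 this).le

/-- **Necessity of STUB 4:** the crux and the light-cone identity imply `LcRatioUpper` (through the PROVED
inclusion half of the sandwich only). -/
theorem lcRatioUpper_of_crux (hc : Theses.CardyBoundaryCoulombGas.HalfPlaneOneArmThird)
    (h₁ : LightconePassage) : LcRatioUpper := by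
  rw [crux_iff] at hc
  intro ε hε
  filter_upwards [rpow_bounds_of_exponentAt hc ε hε, eventually_ge_atTop 1] with N hN h1
  calc passageRatio N (Real.pi / 6) = μ.real (stripWallEvent N) := (h₁ N h1).symm
    _ ≤ prob half N := stripWall_le_arm N
    _ ≤ (N : ℝ) ^ (-(1 / 3 : ℝ) + ε) := hN.2

/-- **Necessity of the light-cone lower bound:** the crux, the identity and the RSW half of the sandwich imply
`LcRatioLower` (the constant `C` is absorbed by `N^{ε/2}`). -/
theorem lcRatioLower_of_crux (hc : Theses.CardyBoundaryCoulombGas.HalfPlaneOneArmThird)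
    (h₁ : LightconePassage) (h₅ : ArmLeStripWall) : LcRatioLower := by
  rw [crux_iff] at hc
  obtain ⟨C, hC, hCle⟩ := h₅
  intro ε hε
  have hε2 : 0 < ε / 2 := by linarith
  have hCN : ∀ᶠ N : ℕ in atTop, C ≤ (N : ℝ) ^ (ε / 2) :=
    ((tendsto_rpow_atTop hε2).comp tendsto_natCast_atTop_atTop).eventually_ge_atTop C
  filter_upwards [rpow_bounds_of_exponentAt hc (ε / 2) hε2, hCN, eventually_ge_atTop 1] with N hN hCN' h1
  have hNpos : (0 : ℝ) < N := by exact_mod_cast h1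
  have hsw : prob half N ≤ C * passageRatio N (Real.pi / 6) := by
    rw [← h₁ N h1]; exact hCle N h1
  have key : (N : ℝ) ^ (-(1 / 3 : ℝ) - ε) * C ≤ (N : ℝ) ^ (-(1 / 3 : ℝ) - ε / 2) := by
    calc (N : ℝ) ^ (-(1 / 3 : ℝ) - ε) * C ≤ (N : ℝ) ^ (-(1 / 3 : ℝ) - ε) * (N : ℝ) ^ (ε / 2) :=
          mul_le_mul_of_nonneg_left hCN' (Real.rpow_nonneg hNpos.le _)
      _ = (N : ℝ) ^ (-(1 / 3 : ℝ) - ε / 2) := by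
          rw [← Real.rpow_add hNpos]; congr 1; ring
  rw [← le_div_iff₀ hC] at key
  calc (N : ℝ) ^ (-(1 / 3 : ℝ) - ε) ≤ (N : ℝ) ^ (-(1 / 3 : ℝ) - ε / 2) / C := key
    _ ≤ prob half N / C := div_le_div_of_nonneg_right hN.1 hC.le
    _ ≤ passageRatio N (Real.pi / 6) := by
          rw [div_le_iff₀ hC]
          calc prob half N ≤ C * passageRatio N (Real.pi / 6) := hsw
            _ = passageRatio N (Real.pi / 6) * C := mul_comm _ _

/-! ## Dictionary pins (PROVED): the first values of the Lean definitions

`S(2;φ) = 1`, `S(3;φ) = 6 cos φ`, `S(4;φ) = 24 cos²φ + 3`, hence `passageRatio 1 φ = (24cos²φ + 3)/(36cos²φ)`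
= `(2c²+1)/(3c²)`, `c = 2cos φ` (the card's hand formula for `L = 3`): `7/9` at the light-cone point (the 2-row
axis strip, `1 - ½(2/3)²` by the geometric series) and `3/4` at the homogeneous point (IP's `A_V(3)A_V(5)/N_8(4)²`).
In particular `stub_diag_le_axis` holds at `N = 1` (checked `example`). -/

theorem Sphi_two (φ : ℝ) : Sphi 2 φ = 1 :=
  Matrix.det_eq_one_of_card_eq_zero (by simp)

theorem Jphi_neg (m : ℕ) (φ : ℝ) (k : ℤ) (hk : k < 0) : Jphi m φ k = 0 := by
  simp [Jphi, hk]

theorem Jphi_three_one (φ : ℝ) : Jphi 3 φ 1 = 6 * Real.cos φ := by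
  have h32 : (Nat.choose 3 2 : ℝ) = 3 := by norm_num [Nat.choose]
  simp only [Jphi, show ¬ (1 : ℤ) < 0 by norm_num, if_false, show (1 : ℤ).toNat = 1 by rfl,
    Finset.sum_range_succ, Finset.sum_range_zero]
  norm_num [h32]
  ring

theorem Sphi_three (φ : ℝ) : Sphi 3 φ = 6 * Real.cos φ := by
  rw [Sphi, Matrix.det_eq_elem_of_card_eq_one (by simp) ⟨0, by norm_num⟩]
  simp [spMatrix, Jphi_three_one]

theorem Jphi_four_zero (φ : ℝ) : Jphi 4 φ 0 = 1 := by
  simp [Jphi]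

theorem Jphi_four_one (φ : ℝ) : Jphi 4 φ 1 = 8 * Real.cos φ := by
  have h43 : (Nat.choose 4 3 : ℝ) = 4 := by norm_num [Nat.choose]
  simp only [Jphi, show ¬ (1 : ℤ) < 0 by norm_num, if_false, show (1 : ℤ).toNat = 1 by rfl,
    Finset.sum_range_succ, Finset.sum_range_zero]
  norm_num [h43]
  ring

theorem Jphi_four_two (φ : ℝ) : Jphi 4 φ 2 = 16 + 20 * Real.cos (2 * φ) := by
  have h43 : (Nat.choose 4 3 : ℝ) = 4 := by norm_num [Nat.choose]
  have h53 : (Nat.choose 5 3 : ℝ) = 10 := by norm_num [Nat.choose]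
  simp only [Jphi, show ¬ (2 : ℤ) < 0 by norm_num, if_false, show (2 : ℤ).toNat = 2 by rfl,
    Finset.sum_range_succ, Finset.sum_range_zero]
  norm_num [h43, h53]
  ring

theorem Sphi_four (φ : ℝ) : Sphi 4 φ = 24 * Real.cos φ ^ 2 + 3 := by
  have hdet : Sphi 4 φ = Matrix.det (spMatrix 4 φ : Matrix (Fin 2) (Fin 2) ℝ) := rfl
  rw [hdet, Matrix.det_fin_two]
  have e00 : (spMatrix 4 φ : Matrix (Fin 2) (Fin 2) ℝ) 0 0 = Jphi 4 φ 1 := by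
    simp [spMatrix]
  have e01 : (spMatrix 4 φ : Matrix (Fin 2) (Fin 2) ℝ) 0 1 = Jphi 4 φ 2 + Jphi 4 φ 0 := by
    simp [spMatrix]
  have e10 : (spMatrix 4 φ : Matrix (Fin 2) (Fin 2) ℝ) 1 0 = Jphi 4 φ 0 := by
    simp [spMatrix]
  have e11 : (spMatrix 4 φ : Matrix (Fin 2) (Fin 2) ℝ) 1 1 = Jphi 4 φ 1 := by
    simp [spMatrix, Jphi_neg]
  rw [e00, e01, e10, e11, Jphi_four_zero, Jphi_four_one, Jphi_four_two, Real.cos_two_mul]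
  ring

theorem passageRatio_one (φ : ℝ) :
    passageRatio 1 φ = (24 * Real.cos φ ^ 2 + 3) / (36 * Real.cos φ ^ 2) := by
  have h2 : Sphi (2 * 1) φ = 1 := Sphi_two φ
  have h3 : Sphi (2 * 1 + 1) φ = 6 * Real.cos φ := Sphi_three φ
  have h4 : Sphi (2 * 1 + 2) φ = 24 * Real.cos φ ^ 2 + 3 := Sphi_four φ
  rw [passageRatio, h2, h3, h4]
  ring

/-- The light-cone pin: `passageRatio 1 (π/6) = 7/9` = `P_{1/2}[stripWallEvent 1]` (2-row axis strip). -/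
theorem passageRatio_one_lightcone : passageRatio 1 (Real.pi / 6) = 7 / 9 := by
  have h3 : Real.sqrt 3 ^ 2 = 3 := Real.sq_sqrt (by norm_num)
  rw [passageRatio_one, Real.cos_pi_div_six, div_pow, h3]
  norm_num

/-- The homogeneous pin: `passageRatio 1 0 = 3/4` = Ikhlef–Ponsaing's `P_b(3)`. -/
theorem passageRatio_one_hom : passageRatio 1 0 = 3 / 4 := by
  rw [passageRatio_one, Real.cos_zero]
  norm_num

/-- `stub_diag_le_axis` at `N = 1`, checked: `3/4 ≤ 7/9`. -/
example : passageRatio 1 0 ≤ passageRatio 1 (Real.pi / 6) := by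
  rw [passageRatio_one_hom, passageRatio_one_lightcone]; norm_num

/-- Wiring check: the registered (sorried) stubs feed `HalfPlaneOneArmThird_of` as stated — kept an `example` so
that `HalfPlaneOneArmThird_of` remains the only theorem of the file concluding the crux. -/
example : Summit.CriticalPhenomena.CardyFormulaZ2.Theses.CardyBoundaryCoulombGas.HalfPlaneOneArmThird :=
  HalfPlaneOneArmThird_of stub_lightconePassage stub_diag_le_axis stub_homRatio_lower stub_lcRatio_upper
    stub_arm_le_stripWall

/-- The shared copy of the crux on route `CardyTotalPositivity` follows verbatim (`Negative.crux_shared`). -/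
example : Summit.CriticalPhenomena.CardyFormulaZ2.Theses.CardyTotalPositivity.HalfPlaneOneArmThird :=
  crux_shared.mp (HalfPlaneOneArmThird_of stub_lightconePassage stub_diag_le_axis stub_homRatio_lower
    stub_lcRatio_upper stub_arm_le_stripWall)

end Summit.CriticalPhenomena.CardyFormulaZ2.Cruxes.HalfPlaneOneArmThird.LightconeSymplecticPassage

end
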